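import Summits.QuantumFields.BalabanUV.T4Continuum.Support.RegionGaugePoincareBox
import Summits.QuantumFields.BalabanUV.T4Continuum.Support.RegionInteriorW2
import Summits.QuantumFields.BalabanUV.T4Continuum.Support.RegionStarLineGaugeTower

/-!
# T⁴ programme, spine node NE2 (U1a), sub-row Δ1 «NE2⁰-Dirichlet» — THE LEVEL-UNIFORM W1 SOCKET ON BOXES and the box star tower
# at the TORUS RATE `L⁻¹` MODULO the tent comparison and W3̃ only

Row NE2 OWNER item O14-a «Δ1-VEC-W1-BOX» (unit `b2b-balaban-t4-ne2-p1`, gen 14; R30 (c) / R31, journal 2026-08-20 l.19379 / l.20053), file 4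
(junction).  Inputs BY NAME: file 3 `Support/RegionGaugePoincareBox` (`sliceCoercive_box_of_tent`: W1 on every coordinate box at every level
`n ≥ 2` with ONE constant `cW1 d a a′ C♭`, modulo the displayed tent comparison `TentComparison`) and leaf-07-g7's «Δ1-VEC-INTERIOR-W2-BOX»
END `Support/RegionInteriorW2.towerLimitRate_star_renorm_box_of_slice` (p232794: on product regions the defect-free star tower of the faithful
`Δ_a(Ω₀)` converges at the torus rate `L⁻¹` modulo W1 (all levels, one constant) + W3̃).

 * §1 LEVEL 0 (`n = 1`, the unit lattice itself): Bałaban's line average is the identity on the star bonds (leaf-09-g9's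
   `RegionStarLineGaugeTower.nsq_avgR_one`, reused BY NAME), so the slice inequality holds there with `c = a` for EVERY region (`sliceCoercive_one`).
 * §2 **`sliceCoercive_lev_box_of_tent`**: for a coordinate box and `L ≥ 2`, `∀ k, SliceCoercive (… lev L k …) (a·n_k^d) (cW1box d a a′ C♭)` with
   `cW1box = min a (cW1 d a a′ C♭)` — THE LEVEL-UNIFORM W1 SOCKET of the owner's star towers (`DirichletStarVectorTower.freeTowerLaws_star_of`,
   `DirichletStarRenormTower.towerLimitRate_star_renorm_of_sq`) and of leaf-07-g7's box END, modulo `∀ k ≥ 1, TentComparison (lev L k) M S C♭`.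
 * §3 **`towerLimitRate_star_renorm_box_of_tent`** = leaf-07-g7's `towerLimitRate_star_renorm_box_of_slice` with `hS` DISCHARGED by §2: on every
   coordinate-box region the renormalised star tower of the faithful region operator converges at the TORUS RATE `L⁻¹` MODULO the tent
   comparison (supplier item «Δ1-VEC-W1-BOX-TENT», leaf-06-g5) and the injected law W3̃ (`hinj`) ONLY.

HONEST FRAMING (T4-DAG p. 1).  Model level (`U = 1`, ONE region = a coordinate box of unit blocks, ONE averaging scale, finite torus, operator
norm); [folklore] bookkeeping over landed modules; the tent comparison and W3̃ are DISPLAYED, not proved; W1 on general unions OPEN and FALSE with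
one constant on unions with codimension-2 exterior contacts (F-ne2leaf09g9-1, R31 (b)); NOT [B9] (3.16)/(3.23)–(3.27) as printed (no `{Ω_j, a_j}`,
no collar mass); NE2 (U1a) NOT proved; spine PROVED 0/9 unchanged; NOT infinite volume / mass gap / Clay.  HONEST DEPENDENCY: continuum YM on T⁴ ⇐
BetaPertH ∧ nine spine estimates (0/9 proved); BetaPertH ⇐ (D1) ∧ (D4) ∧ CAP+tail; G-an2-4 gates asym, D1 and NE2/3/4.  No `sorry`.
-/

noncomputable section

open scoped BigOperators ComplexConjugate Matrix Matrix.Norms.L2Operator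
open Finset

namespace Summit.QuantumFields.BalabanUV.T4Continuum.RegionSliceCoerciveBoxTower

open Literature.MathematicalPhysics.QuantumFieldTheory.Balaban1983to89.B5Prop11Plancherel (Tor fine unitVec)
open Literature.MathematicalPhysics.QuantumFieldTheory.Balaban1983to89.B5Prop11Lower (nsq nsq_nonneg)
open Literature.MathematicalPhysics.QuantumFieldTheory.Balaban1983to89.B5G183RateUnitTower (lev)
open Summit.QuantumFields.BalabanUV.T4Continuum
open Summit.QuantumFields.BalabanUV.T4Continuum.BackgroundResolventTower (Cpert)
open Summit.QuantumFields.BalabanUV.T4Continuum.CovariantAveragingTower (TowerLimitRate)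
open Summit.QuantumFields.BalabanUV.T4Continuum.ScalarAveragedPropagator (gammaPs)
open Summit.QuantumFields.BalabanUV.T4Continuum.RegionGaugeSlice (SliceCoercive)
open Summit.QuantumFields.BalabanUV.T4Continuum.RegionScalarCompression (QOm GOm)
open Summit.QuantumFields.BalabanUV.T4Continuum.RegionGaugeFixedVector (starReg curlR gradR avgR regionDeltaA)
open Summit.QuantumFields.BalabanUV.T4Continuum.DirichletSubregionRenormTower (JnR AnR)
open Summit.QuantumFields.BalabanUV.T4Continuum.DirichletStarVectorTower (starP gamStar two_le_lev_succ)
open Summit.QuantumFields.BalabanUV.T4Continuum.RegionInteriorW2 (CgIbox towerLimitRate_star_renorm_box_of_slice)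
open Summit.QuantumFields.BalabanUV.T4Continuum.RegionGaugePoincareBox (TentComparison cW1 cW1_pos sliceCoercive_box_of_tent)
open Summit.QuantumFields.BalabanUV.T4Continuum.RegionStarLineGaugeTower (nsq_avgR_one)
open Summit.QuantumFields.BalabanUV.Beta.GAN24.DirichletBoxTwoLevel (IsCoordBox)

variable {d : ℕ} (L : ℕ) [NeZero L] (M : Fin d → ℕ) [hM : ∀ μ, NeZero (M μ)] (a a' : ℝ) (S : Tor M → Prop) [DecidablePred S]

/-! ## §1 Level `0`: on the unit lattice the line average is the identity on the star bonds -/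

/-- **THE SLICE INEQUALITY AT LEVEL 0 holds with `c = a` for EVERY region** (indeed for every field, slice or not). [folklore] -/
theorem sliceCoercive_one {c : ℝ} (hc : c ≤ a) :
    SliceCoercive (curlR 1 M S) (gradR 1 M S) (GOm 1 M a' S) (QOm 1 M S) (avgR 1 M S) (a * (((1 : ℕ) : ℕ) : ℝ) ^ d) c := by
  intro A _
  rw [nsq_avgR_one, Nat.cast_one, one_pow, mul_one]
  have h1 := nsq_nonneg (curlR 1 M S *ᵥ A)
  have h2 := nsq_nonneg A
  nlinarith

/-! ## §2 The level-uniform W1 socket on boxes modulo the tent comparison -/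

/-- a smaller constant is still a slice constant. [folklore] -/
theorem sliceCoercive_mono {n : ℕ} [NeZero n] {t c c' : ℝ} (hc : c' ≤ c)
    (h : SliceCoercive (curlR n M S) (gradR n M S) (GOm n M a' S) (QOm n M S) (avgR n M S) t c) :
    SliceCoercive (curlR n M S) (gradR n M S) (GOm n M a' S) (QOm n M S) (avgR n M S) t c' := by
  intro A hA
  have := h A hA
  have h2 := nsq_nonneg A
  nlinarith

/-- the level-uniform box constant `min a (cW1 d a a′ C♭)`. [folklore] -/
def cW1box (d : ℕ) (a a' Cf : ℝ) : ℝ := min a (cW1 d a a' Cf)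

omit [NeZero L] hM [DecidablePred S] in
/-- `0 < cW1box` (`0 < a`, `0 < a′`). [folklore] -/
theorem cW1box_pos {Cf : ℝ} (ha : 0 < a) (ha' : 0 < a') : 0 < cW1box d a a' Cf :=
  lt_min ha (cW1_pos (d := d) a a' ha ha')

/-- **THE LEVEL-UNIFORM W1 SOCKET ON BOXES modulo the tent comparison**: for a coordinate box, `L ≥ 2`, and the tent comparison at every
level `k ≥ 1`, `∀ k, SliceCoercive (… lev L k …) (a·n_k^d) (cW1box d a a′ C♭)`. [folklore] -/
theorem sliceCoercive_lev_box_of_tent (hL : 2 ≤ L) (hbox : IsCoordBox M S) (ha : 0 < a) (ha' : 0 < a') {Cf : ℝ} (hCf : 0 ≤ Cf)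
    (hT : ∀ k, TentComparison (lev L (k + 1)) M S Cf) (k : ℕ) :
    SliceCoercive (curlR (lev L k) M S) (gradR (lev L k) M S) (GOm (lev L k) M a' S) (QOm (lev L k) M S) (avgR (lev L k) M S)
      (a * ((lev L k : ℕ) : ℝ) ^ d) (cW1box d a a' Cf) := by
  cases k with
  | zero => exact sliceCoercive_one M a a' S (min_le_left _ _)
  | succ k =>
    exact sliceCoercive_mono M a' S (min_le_right _ _)
      (sliceCoercive_box_of_tent (lev L (k + 1)) M a a' S hbox (two_le_lev_succ L hL k) ha ha' hCf (hT k))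

/-! ## §3 The box star tower at the torus rate modulo the tent comparison and W3̃ -/

/-- **THE RENORMALISED STAR TOWER ON A BOX AT THE TORUS RATE `L⁻¹`, MODULO THE TENT COMPARISON AND W3̃ ONLY** = leaf-07-g7's
`RegionInteriorW2.towerLimitRate_star_renorm_box_of_slice` with the level-uniform W1 socket `hS` supplied by §2. [folklore] -/
theorem towerLimitRate_star_renorm_box_of_tent (hL : 2 ≤ L) (hbox : IsCoordBox M S) (ha : 0 < a) (ha' : 0 < a') {Cf : ℝ} (hCf : 0 ≤ Cf)
    (hT : ∀ k, TentComparison (lev L (k + 1)) M S Cf)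
    {C₁ : ℝ}
    (hinj : ∀ k, ‖(regionDeltaA (lev L (k + 1)) M a a' S)⁻¹ * JnR L M (starP L M S) k
        - JnR L M (starP L M S) k * (regionDeltaA (lev L k) M a a' S)⁻¹‖ ≤ C₁ * ((L : ℝ)⁻¹) ^ k) :
    TowerLimitRate (AnR L M (starP L M S)) ((L : ℝ) ^ d) (fun k => (regionDeltaA (lev L k) M a a' S)⁻¹)
      (Cpert 0 (Real.sqrt (CgIbox d a' (cW1box d a a' Cf) / 2 * (gamStar d a' (cW1box d a a' Cf))⁻¹)) C₁ 0 0 0) ((L : ℝ)⁻¹) :=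
  towerLimitRate_star_renorm_box_of_slice L M S a a' hL hbox ha.le ha' (cW1box_pos a a' ha ha')
    (sliceCoercive_lev_box_of_tent L M a a' S hL hbox ha ha' hCf hT) hinj

end Summit.QuantumFields.BalabanUV.T4Continuum.RegionSliceCoerciveBoxTower

end
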